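import Mathlib
import HarnessLib
import Summits.ABC.ABC.Theses.NegOmegaAtlas

/-!
# Line `birth` — BC3 skeleton for the crux `UnbalancedFamily` (stmt-ABC-1225)

Route `NegOmegaAtlas` (route-ABC-NegOmegaAtlas, negative side of abc organised by the bounded-ω atlas), crux
`UnbalancedFamily := ∃ k, ∃ η > 0, ∃ δ > 0,
  {abc triples (a,b,c) | ω(abc) ≤ k ∧ min(a,b) ≤ c^(1-η) ∧ quality > 1+δ}.Infinite`
— cell (II-U) of the atlas is inhabited by an infinite "√-scale Pillai" family.

THE LINE = the first tooth of cell (II-U), typed: the two near-equal terms are single PRIME POWERS with exponents ≥ 3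
and the tiny term is a bounded-ω gap of size ≤ c^(1/4) ("prime-power gaps at quarter scale").

* `stub_primePowerGap` (SOURCE, open, the load-bearing stub) — for some ℓ there are arbitrarily large prime powers
  `p^m` (`m ≥ 3`) lying at distance `g ≤ (p^m)^(1/4)` above another prime power `q^n` (`n ≥ 3`), the gap `g` being
  coprime to `q` with at most `ℓ` distinct prime factors.  A Pillai-type statement about gaps between prime powers
  (no `quality`, no `IsABCTriple`, no `Set.Infinite`): its negation is a UNIFORM Pillai finiteness for prime bases,
  open in print (Pillai's conjecture is open for every fixed gap ≥ 2; Scott–Styer bound the NUMBER of solutions per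
  base pair, not their size).  One element is known: `3 + 5^3 = 2^7` (the abc triple (3,125,128), quality 1.4266) —
  see the sorry-free `example` below — and it is the ONLY one with `p^m ≤ 10^18` (direct enumeration of the 82 905
  prime powers `p^m ≤ 10^18`, `m ≥ 3`, by the registering seat; cf. the ω ≤ 3 census attached on stmt-ABC-1227).
* `stub_gapTriple` (TRANSFER, true and provable now, M-sized) — every such gap configuration IS a cell-(II-U) point with
  explicit constants: `(g, q^n, p^m)` is an abc triple, `ω(g·q^n·p^m) ≤ ω(g) + 2`, `min(g, q^n) ≤ (p^m)^(1/2)` and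
  `quality(g, q^n, p^m) > 21/20` (indeed `rad ≤ g·q·p < c^(1/4+1/3+1/3) = c^(11/12)`, so quality > 12/11).
* `unbalancedFamily_of_stubSigs : stub₁-sig → stub₂-sig → UnbalancedFamily` — REAL proof (no sorry): take
  `k = ℓ+2, η = 1/2, δ = 1/20`; if the cell were finite its `c`-coordinates would be bounded by some `N`, but the source
  gives a configuration with `p^m > N` which the transfer puts in the cell.
* `UnbalancedFamily_of : UnbalancedFamily` — THE skeleton theorem (crux BY NAME), `:= unbalancedFamily_of_stubSigs
  stub_primePowerGap stub_gapTriple`.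

`sorry` occurs ONLY in the two `stub_*` theorems.
-/

-- `Summit.<Summit>.<Problem>`: for the single-conjunct summit `ABC` the duplicate `ABC.ABC` is mandated.
set_option linter.dupNamespace false

namespace Summit.ABC.ABC.Cruxes.UnbalancedFamily.Birth

open Literature.NumberTheory.DiophantineGeometry
open Summit.ABC.ABC.Theses.NegOmegaAtlas

/-! ## The two registered stubs -/

/-- **Stub 1 (SOURCE — prime-power gaps at quarter scale; OPEN, load-bearing).**
For some `ℓ` there are arbitrarily large prime powers `p ^ m`, `m ≥ 3`, with another prime power `q ^ n`, `n ≥ 3`,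
at distance `g = p^m - q^n` satisfying `0 < g`, `g^4 ≤ p^m`, `Nat.Coprime g q` and `ω(g) ≤ ℓ`.
Why it might fail: believed FALSE (it gives abc triples of quality > 12/11 with ω ≤ ℓ+2, against abc and against
Baker's ω-explicit refinement; heuristically the expected number of configurations, Σ c^(-5/12) over prime powers
c = p^m with m ≥ 3, converges, and below 10^18 there is exactly one); for FIXED bases `p, q` already false by linear
forms in two logarithms (`|p^m - q^n| > p^(m(1-ε))` for large `m`), so the bases must move. Its negation (a uniform
Pillai-type finiteness over prime bases and unbounded exponents) is open; refuting it kills this line, not the crux.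
Sources: Waldschmidt2014 (Pillai open beyond gap 1), ScottStyer2004, arXiv:2206.14067, Mihailescu2004 (gap 1),
BakerWustholz2007 §3.7. -/
theorem stub_primePowerGap :
    ∃ ℓ : ℕ, ∀ N : ℕ, ∃ g q n p m : ℕ, N < p ^ m ∧ 0 < g ∧ g.primeFactors.card ≤ ℓ ∧ q.Prime ∧ p.Prime ∧
      Nat.Coprime g q ∧ 3 ≤ n ∧ 3 ≤ m ∧ g + q ^ n = p ^ m ∧ g ^ 4 ≤ p ^ m := by
  sorry

/-- **Stub 2 (TRANSFER — a quarter-scale prime-power gap is a cell-(II-U) point with explicit constants; TRUE,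
provable now, est. 80–150 lines).**  If `0 < g`, `q, p` prime, `Nat.Coprime g q`, `n, m ≥ 3`, `g + q^n = p^m` and
`g^4 ≤ p^m`, then `(g, q^n, p^m)` is an abc triple with `ω(g·q^n·p^m) ≤ ω(g) + 2`,
`min(g, q^n) ≤ (p^m)^(1 - 1/2)` and `1 + 1/20 < quality g (q^n) (p^m)`.
Proof sketch: coprimality `Nat.Coprime.pow_right`; `primeFactors` of a product is the union, `(q^n).primeFactors = {q}`;
`g ≤ c^(1/4) ≤ c^(1/2)`; `rad(g·q^n·p^m) ≤ g·q·p` with `g ≤ c^(1/4)`, `p = c^(1/m) ≤ c^(1/3)`, `q^3 ≤ q^n < c`, hence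
`log rad < (11/12) log c`, `rad ≥ 2`, `quality = log c / log rad > 12/11 > 21/20`.
Why it might fail: it does not (elementary real-analysis bookkeeping of the exponents); the risk is only Lean-side
(`Real.rpow`/`Real.log` manipulation). Sources: Masser2002 (quality), Oesterle1988 §1. -/
theorem stub_gapTriple :
    ∀ g q n p m : ℕ, 0 < g → q.Prime → p.Prime → Nat.Coprime g q → 3 ≤ n → 3 ≤ m →
      g + q ^ n = p ^ m → g ^ 4 ≤ p ^ m →
        IsABCTriple g (q ^ n) (p ^ m) ∧
        (g * q ^ n * p ^ m).primeFactors.card ≤ g.primeFactors.card + 2 ∧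
        ((min g (q ^ n) : ℕ) : ℝ) ≤ ((p ^ m : ℕ) : ℝ) ^ (1 - (1 / 2 : ℝ)) ∧
        1 + (1 / 20 : ℝ) < quality g (q ^ n) (p ^ m) := by
  sorry

/-! ## Sanity: the source predicate is inhabited (sorry-free) -/

/-- The one known quarter-scale prime-power gap with exponents ≥ 3: `3 + 5^3 = 2^7` (abc triple (3,125,128),
ω = 3, quality 1.4266); it witnesses the body of `stub_primePowerGap` at `ℓ = 1`, `N = 127`. [folklore] -/
example : ∃ g q n p m : ℕ, 127 < p ^ m ∧ 0 < g ∧ g.primeFactors.card ≤ 1 ∧ q.Prime ∧ p.Prime ∧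
    Nat.Coprime g q ∧ 3 ≤ n ∧ 3 ≤ m ∧ g + q ^ n = p ^ m ∧ g ^ 4 ≤ p ^ m := by
  refine ⟨3, 5, 3, 2, 7, by norm_num, by norm_num, ?_, by norm_num, by norm_num, by norm_num, le_rfl, by norm_num,
    by norm_num, by norm_num⟩
  rw [Nat.Prime.primeFactors (by norm_num : Nat.Prime 3)]
  simp

/-! ## The composition: the two stubs prove the crux BY NAME -/

/-- **Composition (sorry-free).** With `k = ℓ + 2`, `η = 1/2`, `δ = 1/20`: a finite cell would have bounded
`c`-coordinate, but the source supplies gap configurations with `c = p^m` beyond any bound and the transfer places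
each of them in the cell. [folklore] -/
theorem unbalancedFamily_of_stubSigs
    (hA : ∃ ℓ : ℕ, ∀ N : ℕ, ∃ g q n p m : ℕ, N < p ^ m ∧ 0 < g ∧ g.primeFactors.card ≤ ℓ ∧ q.Prime ∧ p.Prime ∧
      Nat.Coprime g q ∧ 3 ≤ n ∧ 3 ≤ m ∧ g + q ^ n = p ^ m ∧ g ^ 4 ≤ p ^ m)
    (hB : ∀ g q n p m : ℕ, 0 < g → q.Prime → p.Prime → Nat.Coprime g q → 3 ≤ n → 3 ≤ m →
      g + q ^ n = p ^ m → g ^ 4 ≤ p ^ m →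
        IsABCTriple g (q ^ n) (p ^ m) ∧
        (g * q ^ n * p ^ m).primeFactors.card ≤ g.primeFactors.card + 2 ∧
        ((min g (q ^ n) : ℕ) : ℝ) ≤ ((p ^ m : ℕ) : ℝ) ^ (1 - (1 / 2 : ℝ)) ∧
        1 + (1 / 20 : ℝ) < quality g (q ^ n) (p ^ m)) :
    UnbalancedFamily := by
  obtain ⟨ℓ, hℓ⟩ := hA
  refine ⟨ℓ + 2, 1 / 2, by norm_num, 1 / 20, by norm_num, ?_⟩
  intro hfin
  obtain ⟨N, hN⟩ := (hfin.image fun t : ℕ × ℕ × ℕ => t.2.2).bddAbove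
  obtain ⟨g, q, n, p, m, hlt, hg, hω, hq, hp, hcop, hn, hm, hsum, hgap⟩ := hℓ N
  obtain ⟨h₁, h₂, h₃, h₄⟩ := hB g q n p m hg hq hp hcop hn hm hsum hgap
  have hmem : (g, q ^ n, p ^ m) ∈ {t : ℕ × ℕ × ℕ | IsABCTriple t.1 t.2.1 t.2.2 ∧
      (t.1 * t.2.1 * t.2.2).primeFactors.card ≤ ℓ + 2 ∧
      ((min t.1 t.2.1 : ℕ) : ℝ) ≤ (t.2.2 : ℝ) ^ (1 - (1 / 2 : ℝ)) ∧
      1 + (1 / 20 : ℝ) < quality t.1 t.2.1 t.2.2} :=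
    ⟨h₁, le_trans h₂ (by omega), h₃, h₄⟩
  have hle : p ^ m ≤ N := mem_upperBounds.mp hN (p ^ m) ⟨(g, q ^ n, p ^ m), hmem, rfl⟩
  exact absurd (lt_of_lt_of_le hlt hle) (lt_irrefl N)

/-- **THE SKELETON THEOREM.** The crux `Summit.ABC.ABC.Theses.NegOmegaAtlas.UnbalancedFamily`, concluded BY NAME
from the two declared stubs. [folklore] -/
theorem UnbalancedFamily_of : Summit.ABC.ABC.Theses.NegOmegaAtlas.UnbalancedFamily :=
  unbalancedFamily_of_stubSigs stub_primePowerGap stub_gapTriple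

end Summit.ABC.ABC.Cruxes.UnbalancedFamily.Birth
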